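import Summits.QuantumFields.BalabanUV.T4Continuum.Spine.NE1p.DressedSuppliedBlockAbsorptionWitness
import Summits.QuantumFields.BalabanUV.T4Continuum.Spine.NE1p.DressedSuppliedAbsorptionWitnessEnd

/-!
# T⁴ programme, spine estimate NE1′ (node O3b/H2) — THE ABSORBED COUNT GROWS, PART 2: the supplier data of `towerQ` (the ℝ-step's law
# WITH EQUALITY at all three kinds of birth, the chain head absorbing SIXTEEN block masses), row S3u §2's supplied ENDs FIRING on it, and
# the GENUINENESS records — S5e's absorbed count `= 16 = (vR·mB)·Λ` and S3i's live count `= 16 = N₀·Λ` ATTAINED (crew row W⟨next⟩)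

Cell `pub-balaban`, sub-cell `t4`, BINDER-OWNERS row NE1′, crew `b2b-balaban-t4-ne1p-formalise-*`, seat `leaf-02` (gen 13).  ADDITIVE —
imports PART 1 `Spine/NE1p/DressedSuppliedBlockAbsorptionWitness` (the datum `towerQ`, `RsQ`, `anchQ`, `SQ`, `compQ`, the function-level
binders) and W37 PART 2 `Spine/NE1p/DressedSuppliedAbsorptionWitnessEnd` (p228137: the window `window_room` at `A = ⅛, vR·mB = 1, ρ′ = ½,
β₀ = ½` BY NAME — unchanged here) ONLY; THEOREMS ONLY (0 def, 0 `def … : Prop`, 0 cite); nothing of S3u ∕ S3i ∕ S5e ∕ S5b ∕ W14 ∕ W18 ∕ W20 ∕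
W32 ∕ W37 ∕ PART 1 is restated.
* §3 supplier data: `hmult_Q` (`mB = 1`, scale `0` by W14's `coords_injective`), `hscale_Q`, `hhoused_Q` (GENUINE at both layers), `hvol_Q`,
  `compVol_RsQ`, `preBelowEnv_RsQ` (equality seam), **`absorbed_sum_blocks`** (`Σ_{absorbs (inr 0)} pre = 16·(3·c₀Q K)` by
  `Fintype.card (Fin 4 → Fin 2) = 2⁴`), `absorbed_sum_chain`, **`absorbLaw_eq`** (EQUALITY: blocks = dressing; chain head = dressing + ⅛ of
  SIXTEEN masses; later = dressing + ⅛ of one), `hβ_Q`.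
* §4 THE END `suppliedBlockAbsorption_fires : (the two COUNTS at their bounds ∧ the head's law records) ∧ DressedStabilityStrict towerQ
  ((2:ℝ)^4)` = row S3u §2's `dressedStabilityStrict_of_suppliedComposition` BY NAME, ONE application, at W37's scalars (`L = 2, c_δ = r = w
  = 1, c̄ = 0, N₀ = A₀ = 1, m = ½, s̄⁰ = 0, ρ′ = ½, θ = ¼, Lb = 2, mB = v = vR = 1, A = ⅛, β₀ = ½`); ROOT-B `dressedBudget_towerQ` with the
  positional count `positionalCount_Q` (`1·16^(k−j)`, ATTAINED at the scale-`1` cube).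
* §5 GENUINENESS BY THEOREM: **`absorbed_count_eq`** (`card (absorbs (inr 0)) = 16 = (vR·mB)·(2⁴)^(1−0)` — S5e's
  `count_absorbs_of_anchoring` bound ATTAINED; the Λ-blind bound `≤ vR·mB` is FALSE: `¬ 16 ≤ 1`), **`live_count_eq`** (the scale-`0`
  fibre of the step-`1` live set has `16 = N₀·Λ^(1−0)` members — S3i's `hcount` ATTAINED on the (γ) face), `absorbed_mass_blocks_pos`,
  `dressing_lt_head` (the sixteen absorbed masses are LOAD-BEARING: `½·(⅛)^(K−1) < 12·cQ K 0`), `twelve_cQ_le` (`≤ (17∕32)·(⅛)^(K−(i+1))`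
  for `K ≥ 1`, induction), `head_lt_class`, `coarsening_acts` (`coarsen 2 1 (coords x) = 0` while `coords x ≠ 0` for `x ≠ 0`).
Planted mutants (NOT filed; rc 1 each): `A := 0` in the END call; `absorbsQ (inr 0) := {inl 0}` in PART 1 (`absorbed_sum_blocks`).

HONEST FRAMING (c4; offered wording) — as PART 1: «Row S3u §2's supplied ENDs fire on a decided (γ)-datum on which S5e's absorbed
count and S3i's live count ATTAIN their positional bounds … at W37's window — the Λ-factor LOAD-BEARING on the END OF RECORD; SHAPES
BY NAME, seams equalities BY DEFINITION, block arithmetic W14's; SOCKET COMPOSITION certified, NOT that components ∕ ℝ-operations of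
[Balaban1989LargeFieldII] were constructed or bounded; S3v's supplied ENDs untouched; discharges no wall item; the wall line does NOT
move; R-t4r2-Q2 NOT met thereby; NE1′ NOT proved.»  [decided toy] ∕ [folklore]; 0 citations.  NE1′ NOT printed, NOT proved; spine
PROVED 0∕9; count 9 unchanged.  Rung (B)+1 on ONE finite four-torus — NOT infinite volume, NOT a mass gap, NOT OS on ℝ⁴, NOT Clay.
HONEST DEPENDENCY: continuum YM on T⁴ ⇐ BetaPertH ∧ nine spine estimates (0/9 proved); BetaPertH ⇐ (D1) ∧ (D4) ∧ CAP+tail; G-an2-4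
gates asym, D1 and NE2/3/4.
-/

noncomputable section

namespace Summit.QuantumFields.BalabanUV.T4Continuum.NE1p.DressedSuppliedBlockAbsorptionWitnessEnd

open Set Metric Finset
open scoped BigOperators
open Literature.MathematicalPhysics.QuantumFieldTheory.Balaban1983to89
open Literature.MathematicalPhysics.QuantumFieldTheory.Balaban1983to89.T4TermFormat
open Literature.MathematicalPhysics.QuantumFieldTheory.Balaban1983to89.T4FeltGeometry
open Literature.MathematicalPhysics.QuantumFieldTheory.Balaban1983to89.T4TrajectoryComparison
open Literature.MathematicalPhysics.QuantumFieldTheory.Balaban1983to89.T4BirthChartTransport (GaugeInvariant BirthSlice RelGauge)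
open Literature.MathematicalPhysics.QuantumFieldTheory.Balaban1983to89.T4PreservedUnderR (RStep)
open Summit.QuantumFields.BalabanUV.T4Continuum.T4TrajectoryDensityDressed
open Summit.QuantumFields.BalabanUV.T4Continuum.NE1p.DressedRoot
open Summit.QuantumFields.BalabanUV.T4Continuum.NE1p.DressedUniformConstants
open Summit.QuantumFields.BalabanUV.T4Continuum.NE1p.DressedAbsorptionWindow
open Summit.QuantumFields.BalabanUV.T4Continuum.NE1p.DressedRootComposition
open Summit.QuantumFields.BalabanUV.T4Continuum.NE1p.DressedStabilityStrictOfSuppliedComposition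
open Summit.QuantumFields.BalabanUV.T4Continuum.NE1p.DressedValueMapWitness (vmap norm_vmap vmap_affine theta_pow_le_one)
open Summit.QuantumFields.BalabanUV.T4Continuum.NE1p.DressedSuppliedAbsorptionWitness (cR cR_pos βR)
open Summit.QuantumFields.BalabanUV.T4Continuum.NE1p.DressedSuppliedAbsorptionWitnessEnd (window_room)
open Summit.QuantumFields.BalabanUV.T4Continuum.NE1p.DressedTowerWitnessBlocks (Blk coords coords_injective coarsen_coords_zero coarsen_coords_succ)
open Summit.QuantumFields.BalabanUV.T4Continuum.NE1p.DressedSuppliedBlockAbsorptionWitness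

/-! ## §3 The supplier data: multiplicity by injective block coordinates, housing at both layers, the ℝ-step with SIXTEEN absorbed masses -/

/-- `hmult`: per-block multiplicity `mB = 1` — at scale `0` by W14's `coords_injective`, above by uniqueness of the chain member. [folklore] -/
theorem hmult_Q (K : ℕ) : ∀ (j : ℕ) (x : Fin 4 → ℕ),
    ((BQ K).births.filter fun b => (BQ K).birthScale b = j ∧ x ∈ (anchQ K).dom b).card ≤ 1 := by
  intro j x
  refine card_le_one.mpr fun f hf f' hf' => ?_
  obtain ⟨hs, hd⟩ := (mem_filter.mp hf).2
  obtain ⟨hs', hd'⟩ := (mem_filter.mp hf').2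
  rcases f with y | i <;> rcases f' with y' | i'
  · have e : x = coords y := Finset.mem_singleton.mp hd
    have e' : x = coords y' := Finset.mem_singleton.mp hd'
    rw [coords_injective (e.symm.trans e')]
  · exact absurd (hs.trans hs'.symm) (by change ¬ (0 = i'.val + 1); omega)
  · exact absurd (hs'.trans hs.symm) (by change ¬ (0 = i.val + 1); omega)
  · have e : i.val + 1 = i'.val + 1 := hs.trans hs'.symm
    rw [show i = i' from Fin.ext (by omega)]

/-- `hscale`: component cubes have the step's scale. [folklore] -/
theorem hscale_Q (K : ℕ) : ∀ k (b : (BQ K).Birth), ∀ q ∈ compQ K k b, (BQ K).cubeScale q = k := by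
  intro k b q hq
  unfold compQ at hq
  split_ifs at hq with h0 hk
  · rcases b with x | i
    · have e : q = Sum.inl x := Finset.mem_singleton.mp hq
      rw [e]; exact h0.symm
    · exact absurd hq (Finset.notMem_empty _)
  · rw [Finset.mem_singleton.mp hq]
    show k - 1 + 1 = k
    omega
  · exact absurd hq (Finset.notMem_empty _)

/-- `hvol`: component volume `v = 1`. [folklore] -/
theorem hvol_Q (K : ℕ) : ∀ k (b : (BQ K).Birth), (compQ K k b).card ≤ 1 := by
  intro k b
  unfold compQ
  split_ifs
  · rcases b with x | i
    · exact (Finset.card_singleton _).le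
    · exact (Nat.zero_le 1)
  · exact (Finset.card_singleton _).le
  · exact (Nat.zero_le 1)

/-- **HOUSING, GENUINE AT BOTH LAYERS** [decided toy]: at step `0` the block family is felt at its own block; at `1 ≤ k ≤ K` every family born
`≤ k` is felt at the origin cube of scale `k`; nothing lives above the cutoff. [folklore] -/
theorem hhoused_Q (K : ℕ) : ∀ k (b : (BQ K).Birth), ∀ f ∈ SQ K k b, ∃ q ∈ compQ K k b, f ∈ (BQ K).feltAt q := by
  intro k b f hf
  unfold SQ at hf
  unfold compQ
  by_cases h0 : k = 0
  · rw [if_pos h0] at hf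
    rw [dif_pos h0]
    rcases b with x | i
    · have e : f = Sum.inl x := Finset.mem_singleton.mp hf
      exact ⟨Sum.inl x, Finset.mem_singleton_self _, by rw [e]; exact Finset.mem_singleton_self _⟩
    · exact absurd hf (Finset.notMem_empty _)
  · rw [if_neg h0] at hf
    rw [dif_neg h0]
    by_cases hk : k ≤ K
    · rw [if_pos hk] at hf
      rw [dif_pos hk]
      refine ⟨Sum.inr ⟨k - 1, by omega⟩, Finset.mem_singleton_self _, Finset.mem_filter.mpr ⟨Finset.mem_univ _, ?_⟩⟩
      show scaleQ K f ≤ k - 1 + 1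
      have := (Finset.mem_filter.mp hf).2
      omega
    · rw [if_neg hk] at hf
      exact absurd hf (Finset.notMem_empty _)

/-- `hcv`: the ℝ-step's component volume `vR = 1` (singletons). [folklore] -/
theorem compVol_RsQ (K : ℕ) : (RsQ K).CompVol 1 := fun _ => (Finset.card_singleton _).le

/-- **THE SEAM AS AN EQUALITY** [decided toy]. [folklore] -/
theorem preBelowEnv_eq (K : ℕ) (b : (BQ K).Birth) (k : ℕ) :
    (RsQ K).pre b (k + 1) = (((2 : ℝ) ^ 2)⁻¹ * 1) * (TQ K).envVar (4 * 1 / 1) (fun _ : ℕ => ((2 : ℝ) ^ 2)⁻¹ * 1) b k := by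
  show preQ K b (k + 1) = _
  unfold preQ
  rw [Nat.add_sub_cancel]

/-- `hpre` — pre-sizes below the transported envelope (indeed equal; any gate). [folklore] -/
theorem preBelowEnv_RsQ (K : ℕ) (Gate : ℕ → Prop) : (TQ K).PreBelowEnv (RsQ K) (4 * 1 / 1) (fun _ : ℕ => ((2 : ℝ) ^ 2)⁻¹ * 1) Gate :=
  fun b k _ _ _ => (preBelowEnv_eq K b k).le

/-- [folklore] A block family's pre-ℝ mass at scale `1` (`preQ`, = `(RsQ K).pre` definitionally) is its transported birth envelope `ψ·(4·gen) = 3·c₀Q K`. -/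
theorem pre_block_one (K : ℕ) (x : Blk 2) : preQ K (Sum.inl x) 1 = 3 * c₀Q K := by
  unfold preQ
  have hb : (TQ K).envVar (4 * 1 / 1) (fun _ : ℕ => ((2 : ℝ) ^ 2)⁻¹ * 1) (Sum.inl x) (1 - 1) =
      4 * 1 / 1 * (TQ K).gen (Sum.inl x) (1 - 1) := Trajectory.envVar_birth (4 * 1 / 1) _ _
  rw [hb]
  show ((2 : ℝ) ^ 2)⁻¹ * 1 * (4 * 1 / 1 * (if (0 : ℕ) = 0 then 3 * c₀Q K else 0)) = 3 * c₀Q K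
  rw [if_pos rfl]; ring

/-- **THE SIXTEEN ABSORBED MASSES** [decided toy]: the chain head's absorbed pre-ℝ mass is `16·(3·c₀Q K)` — the map over the blocks and
`Fintype.card (Fin 4 → Fin 2) = 2⁴`. [folklore] -/
theorem absorbed_sum_blocks (K : ℕ) (h : 0 < K) :
    ∑ b₀ ∈ (RsQ K).absorbs (Sum.inr ⟨0, h⟩), (RsQ K).pre b₀ 1 = 16 * (3 * c₀Q K) := by
  show ∑ b₀ ∈ absorbsQ K (Sum.inr ⟨0, h⟩), preQ K b₀ 1 = _
  simp only [absorbsQ, ↓reduceIte, Finset.sum_map, Function.Embedding.coeFn_mk, pre_block_one, Finset.sum_const, Finset.card_univ,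
    Fintype.card_fun, Fintype.card_fin, nsmul_eq_mul]
  norm_num

/-- [folklore] A later chain member's absorbed pre-ℝ mass is the previous member's transported birth envelope `3·cQ K i`. -/
theorem absorbed_sum_chain (K i : ℕ) (hi : i + 1 < K) :
    ∑ b₀ ∈ (RsQ K).absorbs (Sum.inr ⟨i + 1, hi⟩), (RsQ K).pre b₀ (i + 2) = 3 * cQ K i := by
  show ∑ b₀ ∈ absorbsQ K (Sum.inr ⟨i + 1, hi⟩), preQ K b₀ (i + 2) = _
  simp only [absorbsQ]
  rw [if_neg (show ¬ ((⟨i + 1, hi⟩ : Fin K) : ℕ) = 0 from Nat.succ_ne_zero i), Finset.sum_singleton]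
  unfold preQ
  have hb : (TQ K).envVar (4 * 1 / 1) (fun _ : ℕ => ((2 : ℝ) ^ 2)⁻¹ * 1) (Sum.inr ⟨i + 1 - 1, by omega⟩) (i + 2 - 1) =
      4 * 1 / 1 * (TQ K).gen (Sum.inr ⟨i + 1 - 1, by omega⟩) (i + 2 - 1) := by
    rw [show i + 2 - 1 = (i + 1 - 1) + 1 by omega]
    exact Trajectory.envVar_birth (4 * 1 / 1) _ _
  rw [hb]
  show ((2 : ℝ) ^ 2)⁻¹ * 1 * (4 * 1 / 1 * (if i + 2 - 1 = i + 1 - 1 + 1 then 3 * cQ K (i + 1 - 1) else 0)) = 3 * cQ K i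
  rw [if_pos (by omega), Nat.add_sub_cancel]
  ring

/-- [folklore] Blocks absorb nobody. -/
theorem absorbs_block (K : ℕ) (x : Blk 2) : (RsQ K).absorbs (Sum.inl x) = ∅ := rfl

/-- `hlaw` — **THE ABSORPTION LAW WITH EQUALITY AT ALL THREE KINDS OF BIRTH** [decided toy]: blocks = dressing alone; the chain head =
dressing + one eighth of the SIXTEEN absorbed block masses; later members = dressing + one eighth of the previous member's mass. [folklore] -/
theorem absorbLaw_eq (K : ℕ) (b : (BQ K).Birth) :
    4 * 1 / 1 * (TQ K).gen b ((BQ K).birthScale b) =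
      βR K ((BQ K).birthScale b) + 1 / 8 * ∑ b₀ ∈ (RsQ K).absorbs b, (RsQ K).pre b₀ ((BQ K).birthScale b) := by
  rcases b with x | ⟨i, hi⟩
  · change 4 * 1 / 1 * (if (0 : ℕ) = 0 then 3 * c₀Q K else 0) = βR K 0 + 1 / 8 * ∑ b₀ ∈ (RsQ K).absorbs (Sum.inl x), (RsQ K).pre b₀ 0
    rw [if_pos rfl, absorbs_block, Finset.sum_empty, mul_zero, add_zero]
    unfold βR
    rw [Nat.sub_zero]
    linarith [c₀Q_law K]
  · change 4 * 1 / 1 * (if i + 1 = i + 1 then 3 * cQ K i else 0) =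
      βR K (i + 1) + 1 / 8 * ∑ b₀ ∈ (RsQ K).absorbs (Sum.inr ⟨i, hi⟩), (RsQ K).pre b₀ (i + 1)
    rw [if_pos rfl]
    cases i with
    | zero =>
      rw [absorbed_sum_blocks K hi]
      unfold βR
      have hK : K - 1 = K - (0 + 1) := rfl
      linarith [cQ_zero K]
    | succ j =>
      rw [absorbed_sum_chain K j hi]
      unfold βR
      linarith [cQ_succ K j]

/-- `hlaw` in row S3u's letters. [folklore] -/
theorem absorbLaw_RsQ (K : ℕ) : (TQ K).AbsorbLaw (RsQ K) (4 * 1 / 1) (βR K) (1 / 8) := fun b => (absorbLaw_eq K b).le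

/-- `hβ` with EQUALITY at `β₀ = ½` (W37's dressing). [folklore] -/
theorem hβ_Q (K : ℕ) : ∀ j, j ≤ (BQ K).K → βR K j ≤ 1 / 2 * ((2 : ℝ)⁻¹ ^ 3) ^ ((BQ K).K - j) := fun j _ => by
  show βR K j ≤ 1 / 2 * ((2 : ℝ)⁻¹ ^ 3) ^ (K - j)
  unfold βR
  norm_num


/-! ## §4 THE END: row S3u §2's three supplied ENDs fire with SIXTEEN absorbed families -/

/-- **THE ABSORBED COUNT GROWS ON THE COMPOSITION FACE OF RECORD** [decided toy]: (i) the chain head absorbs `16 = (vR·mB)·(2⁴)^(1−0)` families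
and the step-`1` live set has `16 = N₀·(2⁴)^(1−0)` scale-`0` members (S5e's and S3i's positional bounds ATTAINED), with a positive absorbed
mass and the dressing STRICTLY below the head's birth size, AND (ii) `DressedStabilityStrict towerQ ((2:ℝ)^4)` = row S3u §2's
`dressedStabilityStrict_of_suppliedComposition` BY NAME, ONE application at W37's scalars (`A = ⅛`, `β₀ = ½`, `vR·mB = 1`, window W37's
`window_room`). [folklore] -/
theorem suppliedBlockAbsorption_fires :
    ((∀ K (h : 0 < K), ((RsQ K).absorbs (Sum.inr ⟨0, h⟩)).card = (1 * 1) * (2 ^ 4) ^ (1 - 0)) ∧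
      (∀ K (h : 0 < K) (b : (BQ K).Birth), ((SQ K 1 b).filter fun f => (BQ K).birthScale f = 0).card = 1 * (2 ^ 4) ^ (1 - 0)) ∧
      (∀ K (h : 0 < K), 0 < 1 / 8 * ∑ b₀ ∈ (RsQ K).absorbs (Sum.inr ⟨0, h⟩), (RsQ K).pre b₀ 1) ∧
      (∀ K, 0 < K → βR K 1 < 4 * 1 / 1 * (3 * cQ K 0))) ∧
    DressedStabilityStrict towerQ ((2 : ℝ) ^ 4) := by
  refine ⟨⟨fun K h => ?_, fun K h b => ?_, fun K h => ?_, fun K hK => ?_⟩, ?_⟩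
  · show (absorbsQ K (Sum.inr ⟨0, h⟩)).card = _
    simp only [absorbsQ, ↓reduceIte, Finset.card_map, Finset.card_univ, Fintype.card_fun, Fintype.card_fin]
    norm_num
  · show ((SQ K 1 b).filter fun f => scaleQ K f = 0).card = _
    have h1 : (1 : ℕ) ≤ K := h
    have hS : SQ K 1 b = Finset.univ.filter (fun f => scaleQ K f ≤ 1) := by
      unfold SQ; rw [if_neg Nat.one_ne_zero, if_pos h1]
    have hset : ((SQ K 1 b).filter fun f => scaleQ K f = 0) = Finset.univ.map ⟨Sum.inl, Sum.inl_injective⟩ := by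
      rw [hS]
      ext f
      simp only [Finset.mem_filter, Finset.mem_univ, true_and, Finset.mem_map, Function.Embedding.coeFn_mk]
      rcases f with x | i
      · exact ⟨fun _ => ⟨x, rfl⟩, fun _ => ⟨Nat.zero_le 1, rfl⟩⟩
      · refine ⟨fun hh => absurd hh.2 (Nat.succ_ne_zero _), ?_⟩
        rintro ⟨y, hy⟩
        exact absurd hy Sum.inl_ne_inr
    rw [hset, Finset.card_map, Finset.card_univ, Fintype.card_fun, Fintype.card_fin]
    norm_num
  · rw [absorbed_sum_blocks K h]; exact mul_pos (by norm_num) (mul_pos (by norm_num) (mul_pos (by norm_num) (c₀Q_pos K)))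
  · unfold βR
    have h8 : (1 / 8 : ℝ) ^ K = (1 / 8 : ℝ) ^ (K - 1) * (1 / 8) := by
      rw [← pow_succ]; congr 1; omega
    have := cQ_zero K
    unfold c₀Q at this
    nlinarith [this, h8, pow_pos (show (0:ℝ) < 1 / 8 by norm_num) (K - 1)]
  exact dressedStabilityStrict_of_suppliedComposition towerQ (fun _ K => anchQ K) (fun _ K => RsQ K)
    (L := 2) (cδ := 1) (cbar := 0) (N₀ := 1) (A₀ := 1) (m := 1 / 2) (sbar := 0) (ρ' := 1 / 2) (θ := 1 / 4) (A := 1 / 8) (β₀ := 1 / 2)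
    (mB := 1) (v := 1) (vR := 1)
    (move := fun U d t : ℂ => U + t * d) (N := fun d : ℂ => ‖d‖) (w := 1) (r := 1)
    (moveX := fun U d t : ℂ => U + t * d) (NX := fun d : ℂ => ‖d‖)
    (G := fun _ K b k' => FnQ K b k') (rel := fun _ _ _ _ U U' => U = U') (𝒦 := fun _ _ _ _ => closedBall (0 : ℂ) 1)
    (V := fun _ _ _ k' k => vmap k' k) (𝒦X := fun _ _ _ => closedBall (0 : ℂ) 1) (relX := fun _ _ _ U U' => U = U')
    (δX := fun _ _ _ => (1 : ℝ)) (c := fun _ _ _ => 0) (s₀ := fun _ _ _ _ => 0) (S := fun _ K => SQ K)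
    (comp := fun _ K => compQ K) (β := fun _ K => βR K)
    (by norm_num) zero_le_one one_pos le_rfl zero_le_one zero_le_one (by norm_num)
    (by unfold locOf; norm_num) (by norm_num) (by norm_num)
    (by norm_num) (by norm_num)
    (fun _ _ _ => zero_le_one) (fun _ _ _ => le_rfl) (fun _ _ _ => le_rfl)
    (fun _ K => hG_Q K _) (fun _ K b k' => hinv_Q K b k') (fun U d => by simp)
    (fun _ K => hneX_Q K _) (fun _ K => hsupX_Q K _)
    (fun _ _ _ => le_rfl) (fun _ _ _ _ => le_rfl) (fun _ _ _ _ => le_rfl) (fun _ K => hreg_Q K _)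
    (by norm_num) (fun _ K => hmult_Q K) (fun _ K => hscale_Q K) (fun _ K => hhoused_Q K) (fun _ K => hvol_Q K) (by norm_num)
    (fun _ K => compVol_RsQ K) (fun _ K => preBelowEnv_RsQ K _) (by norm_num) (fun _ K => absorbLaw_RsQ K) (fun _ K => hβ_Q K)
    window_room.1 window_room.2
    (fun _ K => hVK_Q K) (fun _ K => hVrel_Q K)

/-- [folklore] The headline END (N0e `dressedStability_of_strict_comp` BY NAME) — an `example` (closed-statement dedup etiquette). -/
example : DressedStability towerQ := dressedStability_of_strict_comp suppliedBlockAbsorption_fires.2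

/-- **THE POSITIONAL COUNT OF THE BOOKING, ATTAINED** [decided toy]: every scale-`j` fibre of a felt set has `≤ 1·(2⁴)^(k−j)` members —
with EQUALITY `16` at the scale-`1` origin cube for `j = 0` (below: `positionalCount_attained`). [folklore] -/
theorem positionalCount_Q (K : ℕ) : (BQ K).PositionalCount fun j k => 1 * ((2 : ℝ) ^ 4) ^ (k - j) := by
  intro q j
  rcases q with x | i
  · -- a block feels its own family only
    have h1 : (((BQ K).feltAt (Sum.inl x)).filter fun f => (BQ K).birthScale f = j).card ≤ 1 :=
      (Finset.card_filter_le _ _).trans (by show ({Sum.inl x} : Finset (Blk 2 ⊕ Fin K)).card ≤ 1; rw [Finset.card_singleton])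
    have h : ((((BQ K).feltAt (Sum.inl x)).filter fun f => (BQ K).birthScale f = j).card : ℝ) ≤ 1 := by exact_mod_cast h1
    exact h.trans (by simpa using one_le_pow₀ (M₀ := ℝ) (a := (2 : ℝ) ^ 4) (n := (BQ K).cubeScale (Sum.inl x) - j) (by norm_num))
  · -- the origin cube of scale `i+1`: scale-`0` fibre = the sixteen blocks, scale `j ≥ 1` fibre ≤ one chain member
    by_cases hj : j = 0
    · subst hj
      have hsub : (((BQ K).feltAt (Sum.inr i)).filter fun f => (BQ K).birthScale f = 0) ⊆ Finset.univ.map ⟨Sum.inl, Sum.inl_injective⟩ := by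
        intro f hf
        rcases f with y | l
        · exact Finset.mem_map.mpr ⟨y, Finset.mem_univ _, rfl⟩
        · exact absurd (Finset.mem_filter.mp hf).2 (Nat.succ_ne_zero _)
      have h16 : ((((BQ K).feltAt (Sum.inr i)).filter fun f => (BQ K).birthScale f = 0).card : ℝ) ≤ 16 := by
        have := (Finset.card_le_card hsub).trans_eq (by rw [Finset.card_map, Finset.card_univ, Fintype.card_fun, Fintype.card_fin])
        exact_mod_cast this
      refine h16.trans ?_
      show (16 : ℝ) ≤ 1 * ((2 : ℝ) ^ 4) ^ (i.val + 1 - 0)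
      rw [one_mul, Nat.sub_zero, pow_succ]
      have : (1 : ℝ) ≤ ((2 : ℝ) ^ 4) ^ i.val := one_le_pow₀ (by norm_num)
      nlinarith
    · have h1 : (((BQ K).feltAt (Sum.inr i)).filter fun f => (BQ K).birthScale f = j).card ≤ 1 := by
        refine Finset.card_le_one.mpr fun f hf f' hf' => ?_
        have hs := (Finset.mem_filter.mp hf).2
        have hs' := (Finset.mem_filter.mp hf').2
        rcases f with y | l <;> rcases f' with y' | l'
        · exact absurd hs (by change ¬ (0 = j); omega)
        · exact absurd hs (by change ¬ (0 = j); omega)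
        · exact absurd hs' (by change ¬ (0 = j); omega)
        · have e : l.val + 1 = l'.val + 1 := hs.trans hs'.symm
          rw [show l = l' from Fin.ext (by omega)]
      have h : ((((BQ K).feltAt (Sum.inr i)).filter fun f => (BQ K).birthScale f = j).card : ℝ) ≤ 1 := by exact_mod_cast h1
      exact h.trans (by simpa using one_le_pow₀ (M₀ := ℝ) (a := (2 : ℝ) ^ 4) (n := (BQ K).cubeScale (Sum.inr i) - j) (by norm_num))

/-- **ROOT-B FIRES** [decided toy]: `DressedBudget towerQ wt` for bounded nonnegative cube weights (N0e `dressedBudget_of_strict_comp` BY NAME). [folklore] -/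
theorem dressedBudget_towerQ {wt : Unit → ℕ → ℕ → ℝ} {wbar : ℝ} (hwbar : 0 ≤ wbar) (hw0 : ∀ p K, ∀ j ≤ K, 0 ≤ wt p K j)
    (hwb : ∀ p K, ∀ j ≤ K, wt p K j ≤ wbar) : DressedBudget towerQ wt :=
  dressedBudget_of_strict_comp (L := 2) (N₀ := 1) suppliedBlockAbsorption_fires.2 zero_le_one hwbar hw0 hwb fun _ K => positionalCount_Q K

/-! ## §5 GENUINENESS BY THEOREM: both counts at their positional bounds, the sixteen masses load-bearing, the coarsening acts -/

/-- **S5e's ABSORBED COUNT IS ATTAINED** [decided toy]: `card (absorbs (inr 0)) = 16 = (vR·mB)·(2⁴)^(1−0)` — and the Λ-BLIND bound `≤ vR·mB`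
is FALSE on the datum. [folklore] -/
theorem absorbed_count_eq (K : ℕ) (h : 0 < K) :
    ((RsQ K).absorbs (Sum.inr ⟨0, h⟩)).card = (1 * 1) * (2 ^ 4) ^ (1 - 0) ∧ ¬ ((RsQ K).absorbs (Sum.inr ⟨0, h⟩)).card ≤ 1 * 1 := by
  refine ⟨suppliedBlockAbsorption_fires.1.1 K h, ?_⟩
  rw [suppliedBlockAbsorption_fires.1.1 K h]
  norm_num

/-- **S3i's LIVE COUNT IS ATTAINED** [decided toy]: the scale-`0` fibre of every step-`1` live set has `16 = N₀·(2⁴)^(1−0)` members. [folklore] -/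
theorem live_count_eq (K : ℕ) (h : 0 < K) (b : (BQ K).Birth) :
    ((SQ K 1 b).filter fun f => (BQ K).birthScale f = 0).card = 1 * (2 ^ 4) ^ (1 - 0) :=
  suppliedBlockAbsorption_fires.1.2.1 K h b

/-- **THE SIXTEEN ABSORBED MASSES ARE POSITIVE** [decided toy]. [folklore] -/
theorem absorbed_mass_blocks_pos (K : ℕ) (h : 0 < K) :
    0 < 1 / 8 * ∑ b₀ ∈ (RsQ K).absorbs (Sum.inr ⟨0, h⟩), (RsQ K).pre b₀ 1 :=
  suppliedBlockAbsorption_fires.1.2.2.1 K h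

/-- **THE DRESSING ALONE DOES NOT PAY FOR THE CHAIN HEAD** [decided toy]: `βR K 1 < 4·gen (inr 0) 1` — the sixteen absorbed masses are
LOAD-BEARING in `absorbLaw_eq` (the planted mutant `A := 0` breaks the END call). [folklore] -/
theorem dressing_lt_head (K : ℕ) (h : 0 < K) :
    βR K 1 < 4 * 1 / 1 * (TQ K).gen (Sum.inr ⟨0, h⟩) 1 := by
  show βR K 1 < 4 * 1 / 1 * (if (1 : ℕ) = 0 + 1 then 3 * cQ K 0 else 0)
  rw [if_pos rfl]
  exact suppliedBlockAbsorption_fires.1.2.2.2 K h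

/-- **THE CHAIN STAYS AT MOST 17∕32 OF THE CLASS** [arith on the toy]: for `K ≥ 1`, `12·cQ K i ≤ (17∕32)·(⅛)^(K−(i+1))` — the head with
EQUALITY (`½ + 16·⅛·3∕(12·8)·… = 17∕32`), the tail by W37's recursion (`½ + (17∕32)∕32 ≤ 17∕32`). [folklore] -/
theorem twelve_cQ_le (K : ℕ) (hK : 0 < K) : ∀ i, 12 * cQ K i ≤ (17 / 32 : ℝ) * (1 / 8 : ℝ) ^ (K - (i + 1))
  | 0 => by
    rw [cQ_zero]
    unfold c₀Q
    have h8 : (1 / 8 : ℝ) ^ K = (1 / 8 : ℝ) ^ (K - (0 + 1)) * (1 / 8) := by rw [← pow_succ]; congr 1; omega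
    rw [h8]
    have hpos : (0 : ℝ) ≤ (1 / 8 : ℝ) ^ (K - (0 + 1)) := by positivity
    nlinarith
  | i + 1 => by
    have ih := twelve_cQ_le K hK i
    have hmono : (1 / 8 : ℝ) ^ (K - (i + 1)) ≤ (1 / 8 : ℝ) ^ (K - (i + 2)) :=
      pow_le_pow_of_le_one (by norm_num) (by norm_num) (by omega)
    have hpos : (0 : ℝ) ≤ (1 / 8 : ℝ) ^ (K - (i + 2)) := by positivity
    rw [cQ_succ]
    nlinarith

/-- **THE CHAIN HEAD IS BORN STRICTLY INSIDE THE CLASS** [decided toy]: `4·gen (inr 0) 1 < twoRate 1 ρ₁ ⅛ K 1 1 = (⅛)^(K−1)`. [folklore] -/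
theorem head_lt_class (K : ℕ) (h : 0 < K) :
    4 * 1 / 1 * (TQ K).gen (Sum.inr ⟨0, h⟩) 1 < twoRate 1 (rhoOneOf ((2 : ℝ) ^ 2)⁻¹ 1 (4 * 1 / 1) 0) ((2 : ℝ)⁻¹ ^ 3) (BQ K).K 1 1 := by
  show 4 * 1 / 1 * (if (1 : ℕ) = 0 + 1 then 3 * cQ K 0 else 0) < twoRate 1 (rhoOneOf ((2 : ℝ) ^ 2)⁻¹ 1 (4 * 1 / 1) 0) ((2 : ℝ)⁻¹ ^ 3) K 1 1
  rw [if_pos rfl]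
  unfold twoRate
  have hle := twelve_cQ_le K h 0
  have hpos : (0 : ℝ) < (1 / 8 : ℝ) ^ (K - 1) := by positivity
  norm_num at hle ⊢
  nlinarith

/-- **THE COARSENING ACTS** [decided toy]: a block `x ≠ 0` sits at `coords x ≠ 0` yet its family is felt at the origin cube one scale up —
`felt_under` holds only THROUGH `coarsen 2 1 (coords x) = 0` (W14's `coarsen_coords_succ`). [folklore] -/
theorem coarsening_acts (x : Blk 2) (hx : x ≠ 0) : coords x ≠ 0 ∧ coarsen 2 1 (coords x) = 0 :=
  ⟨fun h => hx (coords_injective (by rw [h]; rfl)), coarsen_coords_succ x 0⟩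

/-- [folklore] §5 IN ONE LINE: on `towerQ` the Λ-blind absorbed-count bound `card ≤ vR·mB = 1` FAILS (`16 > 1`) while the positional one holds
with EQUALITY, and the window is still W37's (`A·N = ⅛`, amplitude ⅔). -/
example (K : ℕ) (h : 0 < K) : ¬ ((RsQ K).absorbs (Sum.inr ⟨0, h⟩)).card ≤ 1 * 1 ∧
    fanout (1 / 8) (((1 : ℕ) : ℝ) * ((1 : ℕ) : ℝ)) (1 / 2) < 1 := ⟨(absorbed_count_eq K h).2, window_room.1⟩

end Summit.QuantumFields.BalabanUV.T4Continuum.NE1p.DressedSuppliedBlockAbsorptionWitnessEnd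

end
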